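import Summits.ABC.ABC.Theorems.DefiniteXiFreyModularityStubAbsIrrNegThree
import Literature.NumberTheory.EllipticCurves.SupersingularDensitySerreTraceProofs
import Literature.NumberTheory.EllipticCurves.ModPIrreducibleCongruenceTransferProofs
import Literature.NumberTheory.DiophantineGeometry.GeneralizedFermatTwoPowerCoefficientFreyProofs
import Literature.NumberTheory.Automorphic.CDTTheorem722
import Literature.NumberTheory.EllipticCurves.ComplexMultiplicationLocalFactorsAux
import Mathlib.LinearAlgebra.Trace
import Mathlib.LinearAlgebra.Determinant
import HarnessLib

/-!
# `stub_liftThree` — ideator k3 (GEN 3), HOME FAMILY 3 "probe the extremes": typed companion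

Supersedes nothing, EXTENDS the gen-2 companions `STUB_IDEAS_stub_liftThree_3.lean` (E3–E5) and
`STUB_IDEAS_stub_liftThree_3_Instances.lean` (E1, E2); see `STUB-IDEAS-stub_liftThree-3.md` (gen 3).
Crux `FreyModularity` (item `stmt-ABC-11340`), line `Lines/Sketch.lean`, stub

  `stub_liftThree : ∀ W [IsElliptic] ρ, W.IsTorsionGaloisRep 3 ρ → ρ.IsAbsIrreducibleOverSqrt (-3) →
     ¬ 9 ∣ N_W → ρ.IsModular → W.IsModularGaloisRepTate 3`.

New here (all about the stub's KEY HYPOTHESIS `ρ̄|_{ℚ(√-3)}` abs. irreducible at its two use sites):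

* E7 `isAbsIrreducibleOverSqrt_negThree_of_frobeniusTrace` — a FROBENIUS CERTIFICATE for the
  hypothesis: one good prime `p ≡ 2 (mod 3)` with `3 ∤ a_p(W)` forces an element of order `8` in
  `Im ρ̄_{W,3}` (char. poly `X² ∓ X − 1` over `𝔽₃`, eigenvalues of order `8` in `𝔽₉ˣ`; finite check
  `pow_eight_of_trace_ne_zero_of_det_eq_neg_one`), hence the hypothesis
  (`isAbsIrreducibleOverSqrt_negThree_of_orderOf_eq_eight`, landed).  Complements R3's INERTIA
  certificate at the supersingular prime `3` (`exists_orderOf_eq_eight_of_dvd_frobeniusTrace`).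
* E8 `isAbsIrreducibleOverSqrt_negThree_freyCurve_of_not_five_dvd` — the certificate fires at
  `p = 5` on EVERY Frey curve with `5 ∤ abc`: full rational `2`-torsion gives `4 ∣ #Ẽ(𝔽₅) ∈ {4, 8}`,
  so `a₅ = ±2` (`numPointsMod_freyIntModel_five`, a finite check over `(a, b) mod 5`).  Corollary
  `fifteen_dvd_of_freyCurve_caseB`: case B of `liftThree_of_stubs` (where `stub_switch`,
  `stub_liftFive` and site (B) of `stub_liftThree` are consumed) only contains triples with
  `15 ∣ abc` (with R3: `3 ∣ abc`).  Side remark: a Frey curve good at `5` is ORDINARY at `5`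
  (`a₅ = ±2 ≠ 0`), correcting the aside in `Disproof.lean` B7.
* E6 `siteA_multiplicative_caseA_inhabited` — the cell {multiplicative at `3`} × {case A} of site (A)
  is inhabited IN THE FREY FAMILY (`E_(-1,-2)`, `1 + 2 = 3`; case A by E8, `5 ∤ 6`), so gen-2's
  regime `LiftThreeOrdinary` (E3) is genuinely exercised at site (A), not only at the switched curve.
* Service to `stub_switch` (not this stub's plan): E7 in its model-free form
  `isAbsIrreducibleOverSqrt_negThree_of_lFunction` is the typed ACCEPTANCE TEST for the switched
  curve `W'` — one auxiliary good prime `q ≡ 2 (mod 3)` with `3 ∤ a_q(W')` discharges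
  `ρ̄_{W',3}|_{ℚ(√-3)}` abs. irreducible (Wiles 1995 Ch. 5, p. 543 imposes a `p₁`-adic condition on the
  point of `X_E(5) ≅ ℙ¹`; Rubin CSS 1997 §4 uses Faltings on `Y'_E, Y''_E` instead).
-/

noncomputable section

open scoped MatrixGroups NumberField
open Matrix Field IsDedekindDomain NumberField
open Literature.NumberTheory.EllipticCurves
open Literature.NumberTheory.Automorphic Literature.NumberTheory.Automorphic.BCDT
open Literature.NumberTheory.GaloisRepresentations
open WeierstrassCurve Rat.HeightOneSpectrum
open Summit.ABC.ABC.Theorems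

namespace Summit.ABC.ABC.Cruxes.FreyModularity.StubIdeas3G3

/-- The stub `stub_liftThree` of `Lines/Sketch.lean`, verbatim (= `StubIdeas3.LiftThree`). -/
def LiftThree : Prop :=
  ∀ (W : WeierstrassCurve ℚ) [W.IsElliptic] (ρ : ModPGaloisRep ℚ (ZMod 3) 2),
    W.IsTorsionGaloisRep 3 ρ → ρ.IsAbsIrreducibleOverSqrt (-3) → ¬ 9 ∣ W.conductorNorm ℤ →
      ρ.IsModular → W.IsModularGaloisRepTate 3

/-! ## E7. The Frobenius certificate for `ρ̄|_{ℚ(√-3)}` absolutely irreducible -/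

/-- **Finite check in `M₂(𝔽₃)`**: a matrix with non-zero trace and determinant `-1` — characteristic
polynomial `X² ∓ X - 1`, irreducible over `𝔽₃` with roots of order `8` in `𝔽₉ˣ` — satisfies
`g⁸ = 1 ≠ g⁴`. [folklore] -/
theorem pow_eight_of_trace_ne_zero_of_det_eq_neg_one (g : Matrix (Fin 2) (Fin 2) (ZMod 3))
    (htr : g.trace ≠ 0) (hdet : g.det = -1) : g ^ 8 = 1 ∧ g ^ 4 ≠ 1 := by
  obtain ⟨a, b, c, d, rfl⟩ : ∃ a b c d : ZMod 3, g = !![a, b; c, d] :=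
    ⟨_, _, _, _, Matrix.eta_fin_two g⟩
  rw [Matrix.trace_fin_two_of] at htr
  rw [Matrix.det_fin_two_of] at hdet
  revert a b c d
  decide +kernel

/-- In `GL₂(𝔽₃)`: non-zero trace and determinant `-1` force order `8`. [folklore] -/
theorem orderOf_eq_eight_of_trace_ne_zero (A : GL (Fin 2) (ZMod 3))
    (htr : (A : Matrix (Fin 2) (Fin 2) (ZMod 3)).trace ≠ 0)
    (hdet : (A : Matrix (Fin 2) (Fin 2) (ZMod 3)).det = -1) : orderOf A = 8 := by
  obtain ⟨h8, h4⟩ := pow_eight_of_trace_ne_zero_of_det_eq_neg_one _ htr hdet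
  have h : orderOf A = 2 ^ (2 + 1) := by
    refine orderOf_eq_prime_pow (p := 2) (n := 2) (fun h1 ↦ h4 ?_) ?_
    · have := congrArg (fun B : GL (Fin 2) (ZMod 3) ↦ (B : Matrix (Fin 2) (Fin 2) (ZMod 3))) h1
      simpa [Units.val_pow_eq_pow_val] using this
    · ext : 1
      simpa [Units.val_pow_eq_pow_val] using h8
  simpa using h

section Frame

variable {V : WeierstrassCurve ℚ}

/-- In a frame `e` the `𝔽₃`-linear trace of `σ` on `V[3]` is the trace of its matrix (copy of the
BSD seat's `EtaCartanField.trace_eq_matrix_trace`, kept local to avoid a cross-summit import).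
[folklore] -/
theorem trace_eq_matrix_trace {p : ℕ} (e : V.geomTorsion p ≃+ (Fin 2 → ZMod p))
    {σ : absoluteGaloisGroup ℚ} {M : Matrix (Fin 2) (Fin 2) (ZMod p)}
    (hσ : ∀ P : V.geomTorsion p, e (σ • P) = M.mulVec (e P)) :
    letI : Module (ZMod p) (V.geomTorsion p) := AddSubgroup.torsionBy.zmodModule
    LinearMap.trace (ZMod p) (V.geomTorsion p)
        ((galoisRepTorsion V p σ).toAdd.toAddMonoidHom.toZModLinearMap p) = M.trace := by
  letI : Module (ZMod p) (V.geomTorsion p) := AddSubgroup.torsionBy.zmodModule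
  let eL : V.geomTorsion p ≃ₗ[ZMod p] (Fin 2 → ZMod p) :=
    LinearEquiv.ofBijective (e.toAddMonoidHom.toZModLinearMap p) ⟨e.injective, e.surjective⟩
  have heL : ∀ Q : V.geomTorsion p, eL Q = e Q := fun _ ↦ rfl
  have hconj : Matrix.toLin' M =
      eL.conj ((galoisRepTorsion V p σ).toAdd.toAddMonoidHom.toZModLinearMap p) := by
    refine LinearMap.ext fun v ↦ ?_
    obtain ⟨Q, rfl⟩ := eL.surjective v
    rw [LinearEquiv.conj_apply_apply, eL.symm_apply_apply, heL, heL, Matrix.toLin'_apply]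
    change M.mulVec (e Q) = e (σ • Q)
    rw [hσ]
  rw [← LinearMap.trace_conj' _ eL, ← hconj,
    LinearMap.trace_eq_matrix_trace (ZMod p) (Pi.basisFun (ZMod p) (Fin 2)),
    LinearMap.toMatrix_eq_toMatrix', LinearMap.toMatrix'_toLin']

/-- Twin of `trace_eq_matrix_trace` for the determinant (copy of the BSD seat's
`EtaCartanField.det_eq_matrix_det`). [folklore] -/
theorem det_eq_matrix_det {p : ℕ} (e : V.geomTorsion p ≃+ (Fin 2 → ZMod p))
    {σ : absoluteGaloisGroup ℚ} {M : Matrix (Fin 2) (Fin 2) (ZMod p)}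
    (hσ : ∀ P : V.geomTorsion p, e (σ • P) = M.mulVec (e P)) :
    letI : Module (ZMod p) (V.geomTorsion p) := AddSubgroup.torsionBy.zmodModule
    LinearMap.det ((galoisRepTorsion V p σ).toAdd.toAddMonoidHom.toZModLinearMap p) = M.det := by
  letI : Module (ZMod p) (V.geomTorsion p) := AddSubgroup.torsionBy.zmodModule
  let eL : V.geomTorsion p ≃ₗ[ZMod p] (Fin 2 → ZMod p) :=
    LinearEquiv.ofBijective (e.toAddMonoidHom.toZModLinearMap p) ⟨e.injective, e.surjective⟩
  have heL : ∀ Q : V.geomTorsion p, eL Q = e Q := fun _ ↦ rfl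
  have hconj : Matrix.toLin' M =
      eL.conj ((galoisRepTorsion V p σ).toAdd.toAddMonoidHom.toZModLinearMap p) := by
    refine LinearMap.ext fun v ↦ ?_
    obtain ⟨Q, rfl⟩ := eL.surjective v
    rw [LinearEquiv.conj_apply_apply, eL.symm_apply_apply, heL, heL, Matrix.toLin'_apply]
    change M.mulVec (e Q) = e (σ • Q)
    rw [hσ]
  rw [← LinearMap.det_toLin' M, hconj, LinearEquiv.conj_apply, LinearMap.comp_assoc, LinearMap.det_conj]

/-- A framed model of `E[n]` is a framed model of `E'[n]` along a bijective isogeny (local copy of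
`Summit.ABC.ABC.Theorems.isTorsionGaloisRep_of_isogeny_bijective`, `…StubAbsIrrSqrtFiveLocal`,
whose olean the farm did not serve to this seat; R3 keeps the same copy private). [folklore] -/
theorem isTorsionGaloisRep_of_isogeny_bijective'' {K : Type*} [Field K]
    {W W' : WeierstrassCurve K} (κ : Isogeny W W') (hκ : Function.Bijective κ) {n : ℕ}
    {ρ : FramedGaloisRep K (ZMod n) 2} (h : W.IsTorsionGaloisRep n ρ) :
    W'.IsTorsionGaloisRep n ρ := by
  have hmem : ∀ P : geomTorsion W n, κ (P : W.geomPoints) ∈ geomTorsion W' n := fun P ↦ by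
    have hP : (n : ℤ) • (P : W.geomPoints) = 0 := (Submodule.mem_torsionBy_iff (n : ℤ) _).mp P.2
    refine (Submodule.mem_torsionBy_iff (n : ℤ) _).mpr ?_
    rw [← map_zsmul, hP, map_zero]
  let f : geomTorsion W n → geomTorsion W' n := fun P ↦ ⟨κ (P : W.geomPoints), hmem P⟩
  have hf : Function.Bijective f := by
    constructor
    · intro P Q hPQ
      exact Subtype.ext (hκ.1 (congrArg Subtype.val hPQ))
    · intro Q
      obtain ⟨P, hP⟩ := hκ.2 (Q : W'.geomPoints)
      have hPn : P ∈ geomTorsion W n := by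
        refine (Submodule.mem_torsionBy_iff (n : ℤ) _).mpr (hκ.1 ?_)
        have hQ : (n : ℤ) • (Q : W'.geomPoints) = 0 :=
          (Submodule.mem_torsionBy_iff (n : ℤ) _).mp Q.2
        rw [map_zsmul, hP, hQ, map_zero]
      exact ⟨⟨P, hPn⟩, Subtype.ext hP⟩
  let f' : geomTorsion W n →+ geomTorsion W' n :=
    { toFun := f
      map_zero' := Subtype.ext (map_zero κ)
      map_add' := fun P Q ↦ Subtype.ext (map_add κ (P : W.geomPoints) (Q : W.geomPoints)) }
  let ε : geomTorsion W n ≃+ geomTorsion W' n := AddEquiv.ofBijective f' hf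
  have hε : ∀ P : geomTorsion W n,
      ((ε P : geomTorsion W' n) : W'.geomPoints) = κ (P : W.geomPoints) := fun P ↦ rfl
  have hεsmul : ∀ (σ : absoluteGaloisGroup K) (P : geomTorsion W n), ε (σ • P) = σ • ε P := by
    intro σ P
    apply Subtype.ext
    rw [hε, AddSubgroup.torsionBy.coe_smul, κ.map_smul, AddSubgroup.torsionBy.coe_smul, hε]
  obtain ⟨e, he⟩ := h
  refine ⟨ε.symm.trans e, fun σ Q ↦ ?_⟩
  have hQ : ε.symm (σ • Q) = σ • ε.symm Q := by
    apply ε.injective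
    rw [AddEquiv.apply_symm_apply, hεsmul, AddEquiv.apply_symm_apply]
  rw [AddEquiv.trans_apply, AddEquiv.trans_apply, hQ, he]

end Frame

/-- **E7 — Frobenius certificate (Serre 1972 §2; the `ℓ = 3` twin of the tree's
`hasIrreducibleModPGaloisRep_of_frobeniusTraceAt_noroot`).**  Let `W/ℚ` be elliptic in global
minimal form, `p ≠ 3` a good prime with `p ≡ 2 (mod 3)` and `3 ∤ a_p(W)`.  Then for every framed
model `ρ̄` of `W[3]`, `ρ̄|_{ℚ(√-3)}` is absolutely irreducible: an arithmetic Frobenius `σ` at `p` acts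
on `W[3]` with trace `a_p ≢ 0` and determinant `p ≡ -1 (mod 3)` (Serre 1981 (238); DDT Prop. 2.8),
so `ρ̄(σ)` has order `8` (`orderOf_eq_eight_of_trace_ne_zero`), and an element of order `8` together
with `det ρ̄ = χ̄₃` gives the claim (`isAbsIrreducibleOverSqrt_negThree_of_orderOf_eq_eight`).
[cite: Serre1972, §2.2] [cite: Serre1981, §8.1 eq. (238)] -/
theorem isAbsIrreducibleOverSqrt_negThree_of_frobeniusTrace (W : WeierstrassCurve ℚ)
    [W.IsElliptic] [W.IsGloballyMinimal] {p : ℕ} [Fact p.Prime] (hp3 : p ≠ 3)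
    (hgood : W.HasGoodReductionAtPrime p) (hp : (p : ZMod 3) = -1)
    (ha : ¬ (3 : ℤ) ∣ W.frobeniusTrace p) {ρ : ModPGaloisRep ℚ (ZMod 3) 2}
    (hρ : W.IsTorsionGaloisRep 3 ρ) : ρ.IsAbsIrreducibleOverSqrt (-3) := by
  classical
  haveI : Fact (Nat.Prime 3) := ⟨Nat.prime_three⟩
  obtain ⟨v, hv⟩ : ∃ v : HeightOneSpectrum (𝓞 ℚ), (primesEquiv v : ℕ) = p :=
    ⟨primesEquiv.symm ⟨p, Fact.out⟩, by rw [Equiv.apply_symm_apply]⟩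
  obtain ⟨𝔓, h𝔓⟩ := HeightOneSpectrum.primesAbove_nonempty v
  obtain ⟨σ, hσ⟩ := HeightOneSpectrum.exists_isArithFrobAt_of_mem_primesAbove_holds h𝔓
  obtain ⟨e, he⟩ := id hρ
  set M : Matrix (Fin 2) (Fin 2) (ZMod 3) :=
    ((ρ σ : GL (Fin 2) (ZMod 3)) : Matrix (Fin 2) (Fin 2) (ZMod 3)) with hM
  have htr : M.trace = (W.frobeniusTrace p : ZMod 3) := by
    rw [← trace_eq_matrix_trace e (he σ), W.trace_galoisRepTorsion_frobenius_eq 3 hp3 hgood hv h𝔓 hσ]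
  have hdet : M.det = -1 := by
    rw [← det_eq_matrix_det e (he σ), W.det_galoisRepTorsion_frobenius_eq 3 hp3 hgood hv h𝔓 hσ, hp]
  have htr0 : M.trace ≠ 0 := by
    rw [htr]
    intro h0
    exact ha ((ZMod.intCast_zmod_eq_zero_iff_dvd _ 3).mp h0)
  have hord : orderOf (ρ σ) = 8 := orderOf_eq_eight_of_trace_ne_zero (ρ σ) htr0 hdet
  exact isAbsIrreducibleOverSqrt_negThree_of_orderOf_eq_eight ρ
    (W.det_eq_modPCyclotomicCharacter_of_isTorsionGaloisRep_holds 3 ρ hρ) hord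

/-- **E7, model-free form** (any elliptic `W/ℚ`, the `L`-function coefficient `a_p = L(W)_p` in place
of the minimal-model trace): pass to a global minimal model `C • W` (`hasGlobalMinimalModel_rat_holds`;
same `L`-function `LFunction_smul`, same `3`-torsion module `isTorsionGaloisRep_of_isogeny_bijective`,
good reduction is a `ℚ`-isomorphism invariant `hasGoodReductionAt_smul_iff_holds`).
[cite: Serre1972, §2.2] -/
theorem isAbsIrreducibleOverSqrt_negThree_of_lFunction (W : WeierstrassCurve ℚ) [W.IsElliptic]
    {p : ℕ} [Fact p.Prime] (hp3 : p ≠ 3) (hgood : W.HasGoodReductionAtPrime p)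
    (hp : (p : ZMod 3) = -1) (ha : ¬ (3 : ℤ) ∣ W.LFunction p) {ρ : ModPGaloisRep ℚ (ZMod 3) 2}
    (hρ : W.IsTorsionGaloisRep 3 ρ) : ρ.IsAbsIrreducibleOverSqrt (-3) := by
  obtain ⟨C, hC⟩ := hasGlobalMinimalModel_rat_holds W
  haveI := hC
  obtain ⟨v, hv⟩ : ∃ v : HeightOneSpectrum (𝓞 ℚ), (primesEquiv v : ℕ) = p :=
    ⟨primesEquiv.symm ⟨p, Fact.out⟩, by rw [Equiv.apply_symm_apply]⟩
  have hgood' : (C • W).HasGoodReductionAtPrime p := by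
    rw [hasGoodReductionAtPrime_primesEquiv_iff_holds (C • W) v p hv,
      WeierstrassCurve.hasGoodReductionAt_smul_iff_holds v W C]
    exact (hasGoodReductionAtPrime_primesEquiv_iff_holds W v p hv).mp hgood
  have hρ' : (C • W).IsTorsionGaloisRep 3 ρ :=
    isTorsionGaloisRep_of_isogeny_bijective'' (VariableChange.toIsogeny W C)
      ⟨VariableChange.toIsogeny_injective W C, VariableChange.toIsogeny_surjective W C⟩ hρ
  have ha' : ¬ (3 : ℤ) ∣ (C • W).frobeniusTrace p := by
    rwa [← LFunction_apply_prime_eq_frobeniusTrace (C • W) p hgood', LFunction_smul]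
  exact isAbsIrreducibleOverSqrt_negThree_of_frobeniusTrace (C • W) hp3 hgood' hp ha' hρ'

/-! ## E8. The certificate fires at `p = 5` on every Frey curve with `5 ∤ abc` -/

/-- `5 ∤ ab(a+b)` read in `𝔽₅`. [folklore] -/
theorem intCast_mul_ne_zero_of_not_five_dvd {a b : ℤ} (h5 : ¬ (5 : ℤ) ∣ a * b * (a + b)) :
    (a : ZMod 5) * b * (a + b) ≠ 0 := by
  intro h0
  apply h5
  have h1 : ((a * b * (a + b) : ℤ) : ZMod 5) = 0 := by push_cast; exact h0
  exact (ZMod.intCast_zmod_eq_zero_iff_dvd _ 5).mp h1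

/-- **Finite check over `𝔽₅`**: for `u, w ∈ 𝔽₅` with `uw(u+w) ≠ 0` the curve
`y² = x³ + (w - u)x² - uw·x = x(x - u)(x + w)` has `4` or `8` points over `𝔽₅` (full rational
`2`-torsion forces `4 ∣ #E(𝔽₅)`, Hasse forces `#E(𝔽₅) ∈ [2, 10]`; checked by enumeration of the
`12` admissible residue pairs). [folklore] -/
theorem natCard_point_frey_zmod_five : ∀ u w : ZMod 5, u * w * (u + w) ≠ 0 →
    Nat.card ((⟨0, w - u, 0, -(u * w), 0⟩ : WeierstrassCurve (ZMod 5)).toAffine.Point) = 4 ∨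
    Nat.card ((⟨0, w - u, 0, -(u * w), 0⟩ : WeierstrassCurve (ZMod 5)).toAffine.Point) = 8 := by
  intro u w h
  fin_cases u <;> fin_cases w <;> first
    | exact (h (by decide)).elim
    | (rw [WeierstrassCurve.natCard_point_eq_one_add_card _ (by decide)]; decide +kernel)

/-- The integral Frey model `y² = x³ + (b - a)x² - ab·x` reduced modulo `5`. [folklore] -/
theorem map_freyIntModel_zmod_five (a b : ℤ) :
    (freyIntModel a b).map (Int.castRingHom (ZMod 5)) =
      ⟨0, (b : ZMod 5) - a, 0, -((a : ZMod 5) * b), 0⟩ := by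
  ext <;> simp [freyIntModel]

/-- **`#Ẽ_(a,b)(𝔽₅) ∈ {4, 8}` for `5 ∤ abc`.** [folklore] -/
theorem numPointsMod_freyIntModel_five {a b : ℤ} (h5 : ¬ (5 : ℤ) ∣ a * b * (a + b)) :
    numPointsMod (freyIntModel a b) 5 = 4 ∨ numPointsMod (freyIntModel a b) 5 = 8 := by
  unfold numPointsMod
  rw [map_freyIntModel_zmod_five]
  exact natCard_point_frey_zmod_five _ _ (intCast_mul_ne_zero_of_not_five_dvd h5)

/-- **`a₅ = ±2` on the integral Frey model when `5 ∤ abc`** — in particular the reduction at `5` is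
ORDINARY, never supersingular. [folklore] -/
theorem frobeniusTrace_freyIntModel_five {a b : ℤ} (h5 : ¬ (5 : ℤ) ∣ a * b * (a + b)) :
    Literature.NumberTheory.Automorphic.frobeniusTrace (freyIntModel a b) 5 = 2 ∨
      Literature.NumberTheory.Automorphic.frobeniusTrace (freyIntModel a b) 5 = -2 := by
  unfold Literature.NumberTheory.Automorphic.frobeniusTrace
  rcases numPointsMod_freyIntModel_five h5 with h | h <;> rw [h] <;> norm_num

/-- `5 ∤ Δ = 16 (ab(a+b))²` for the integral Frey model when `5 ∤ abc`. [folklore] -/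
theorem not_five_dvd_freyIntModel_Δ {a b : ℤ} (h5 : ¬ (5 : ℤ) ∣ a * b * (a + b)) :
    ¬ (5 : ℤ) ∣ (freyIntModel a b).Δ := by
  rw [freyIntModel_Δ]
  intro h
  have hp : Prime (5 : ℤ) := Int.prime_iff_natAbs_prime.mpr (by norm_num)
  rcases hp.dvd_or_dvd h with h16 | hsq
  · norm_num at h16
  · exact h5 (hp.dvd_of_dvd_pow hsq)

/-- **`a₅(E_(a,b)) = ±2` for `5 ∤ abc`** (fifth coefficient of `L(E_(a,b), s)`, computed on the
integral model: `lFunction_map_apply_prime_of_not_dvd`, Silverman Ex. 8.19(a)).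
[cite: SilvermanAEC2009, Exercise 8.19(a)] -/
theorem lFunction_freyCurve_five {a b : ℤ} (h5 : ¬ (5 : ℤ) ∣ a * b * (a + b)) :
    (freyCurve a b).LFunction 5 = 2 ∨ (freyCurve a b).LFunction 5 = -2 := by
  rw [← map_freyIntModel_intCastRingHom,
    lFunction_map_apply_prime_of_not_dvd _ Nat.prime_five
      (by exact_mod_cast not_five_dvd_freyIntModel_Δ h5)]
  exact frobeniusTrace_freyIntModel_five h5

/-- The Frey curve has good reduction at the place over `5` when `5 ∤ abc`. [folklore] -/
theorem hasGoodReductionAt_freyCurve_five {a b : ℤ} (h5 : ¬ (5 : ℤ) ∣ a * b * (a + b))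
    {v : HeightOneSpectrum (𝓞 ℚ)} (hv : (primesEquiv v : ℕ) = 5) :
    (freyCurve a b).HasGoodReductionAt v := by
  rw [← map_freyIntModel_intCastRingHom]
  refine hasGoodReductionAt_map_of_not_dvd (freyIntModel a b) v ?_
  rw [hv]
  exact_mod_cast not_five_dvd_freyIntModel_Δ h5

/-- Prime-indexed form: `E_(a,b)` has good reduction at `5` when `5 ∤ abc`. [folklore] -/
theorem hasGoodReductionAtPrime_freyCurve_five {a b : ℤ} (h5 : ¬ (5 : ℤ) ∣ a * b * (a + b)) :
    haveI : Fact (Nat.Prime 5) := ⟨Nat.prime_five⟩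
    (freyCurve a b).HasGoodReductionAtPrime 5 := by
  haveI : Fact (Nat.Prime 5) := ⟨Nat.prime_five⟩
  set v : HeightOneSpectrum (𝓞 ℚ) := (primesEquiv (R := 𝓞 ℚ)).symm ⟨5, Nat.prime_five⟩ with hvdef
  have hv : (primesEquiv v : ℕ) = 5 := by rw [hvdef, Equiv.apply_symm_apply]
  rw [hasGoodReductionAtPrime_primesEquiv_iff_holds (freyCurve a b) v 5 hv]
  exact hasGoodReductionAt_freyCurve_five h5 hv

/-- **E8 — every Frey curve with `5 ∤ abc` is in case A of the composition**: for `a ⊥ b`,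
`ab(a+b) ≠ 0`, `5 ∤ abc` and every framed model `ρ̄` of `E_(a,b)[3]`, `ρ̄|_{ℚ(√-3)}` is absolutely
irreducible — `E_(a,b)` is good at `5 ≡ 2 (mod 3)` with `a₅ = ±2`, `3 ∤ a₅` (E7).  Twin of R3's
`isAbsIrreducibleOverSqrt_negThree_freyCurve_of_not_three_dvd` (`3 ∤ abc`, inertia at `3`).
[cite: Serre1972, §2.2] [cite: ConradDiamondTaylor1999, Thm. 7.1.2 (proof, p. 556)] -/
theorem isAbsIrreducibleOverSqrt_negThree_freyCurve_of_not_five_dvd :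
    ∀ a b : ℤ, IsCoprime a b → a * b * (a + b) ≠ 0 → ¬ (5 : ℤ) ∣ a * b * (a + b) →
      ∀ ρ : ModPGaloisRep ℚ (ZMod 3) 2, (freyCurve a b).IsTorsionGaloisRep 3 ρ →
        ρ.IsAbsIrreducibleOverSqrt (-3) := by
  intro a b _ h0 h5 ρ hρ
  haveI := isElliptic_freyCurve h0
  haveI : Fact (Nat.Prime 5) := ⟨Nat.prime_five⟩
  refine isAbsIrreducibleOverSqrt_negThree_of_lFunction (freyCurve a b) (p := 5) (by norm_num)
    (hasGoodReductionAtPrime_freyCurve_five h5) (by decide) ?_ hρ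
  rcases lFunction_freyCurve_five h5 with h | h <;> rw [h] <;> omega

/-- **Case B lives on `15 ∣ abc`.**  If NO framed model of `E_(a,b)[3]` is absolutely irreducible
over `ℚ(√-3)` (case B of `liftThree_of_stubs`, where Wiles' `3`–`5` switch is invoked), then
`3 ∣ abc` (R3) and `5 ∣ abc` (E8). [cite: ConradDiamondTaylor1999, Thm. 7.1.2 (proof, p. 556)] -/
theorem fifteen_dvd_of_freyCurve_caseB {a b : ℤ} (hab : IsCoprime a b) (h0 : a * b * (a + b) ≠ 0)
    (hB : ∀ ρ : ModPGaloisRep ℚ (ZMod 3) 2, (freyCurve a b).IsTorsionGaloisRep 3 ρ →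
      ¬ ρ.IsAbsIrreducibleOverSqrt (-3)) :
    (15 : ℤ) ∣ a * b * (a + b) := by
  haveI := isElliptic_freyCurve h0
  haveI : Fact (Nat.Prime 3) := ⟨Nat.prime_three⟩
  obtain ⟨ρ, hρ⟩ := (freyCurve a b).exists_isTorsionGaloisRep 3
  have h3 : (3 : ℤ) ∣ a * b * (a + b) := by
    by_contra h3
    exact hB ρ hρ (isAbsIrreducibleOverSqrt_negThree_freyCurve_of_not_three_dvd a b hab h0 h3 ρ hρ)
  have h5 : (5 : ℤ) ∣ a * b * (a + b) := by
    by_contra h5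
    exact hB ρ hρ (isAbsIrreducibleOverSqrt_negThree_freyCurve_of_not_five_dvd a b hab h0 h5 ρ hρ)
  omega

/-! ## E6. Site (A): the cell {multiplicative at `3`} × {case A} is inhabited in the Frey family -/

/-- **The triple `1 + 2 = 3`** (`E_(-1,-2) : y² = x(x+1)(x-2)`, the normalisation `A ≡ -1 (mod 4)`,
`2 ∥ B`): coprime, `3 ∣ abc` so MULTIPLICATIVE at `3` (Serre 1987 (4.1.2)), `9 ∤ N`, and in case A
(`5 ∤ 6`, E8) — so the regime `LiftThreeOrdinary` of gen-2's E3 is met at site (A) itself, by a curve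
that is NOT semistable (additive at `2`): the hypothesis class of `stub_liftThree` at site (A) is not
exhausted by R3's supersingular curves. [cite: Serre1987, §4.1 (4.1.2)] -/
theorem siteA_multiplicative_caseA_inhabited :
    ∃ a b : ℤ, IsCoprime a b ∧ a * b * (a + b) ≠ 0 ∧
      (∃ ρ : ModPGaloisRep ℚ (ZMod 3) 2,
          (freyCurve a b).IsTorsionGaloisRep 3 ρ ∧ ρ.IsAbsIrreducibleOverSqrt (-3)) ∧
      ¬ 9 ∣ (freyCurve a b).conductorNorm ℤ ∧ (3 : ℤ) ∣ a * b * (a + b) ∧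
      ∀ v : HeightOneSpectrum ℤ, natGenerator v = 3 →
        (freyCurve a b).HasMultiplicativeReductionAt v := by
  have hab : IsCoprime (-1 : ℤ) (-2) := isCoprime_one_left.neg_left
  have h0 : (-1 : ℤ) * (-2) * (-1 + -2) ≠ 0 := by norm_num
  haveI := isElliptic_freyCurve h0
  haveI : Fact (Nat.Prime 3) := ⟨Nat.prime_three⟩
  obtain ⟨ρ, hρ⟩ := (freyCurve (-1) (-2)).exists_isTorsionGaloisRep 3
  refine ⟨-1, -2, hab, h0, ⟨ρ, hρ, ?_⟩, not_nine_dvd_conductorNorm_freyCurve hab h0, by norm_num,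
    fun v hv ↦ ?_⟩
  · exact isAbsIrreducibleOverSqrt_negThree_freyCurve_of_not_five_dvd (-1) (-2) hab h0
      (by norm_num) ρ hρ
  · refine Literature.NumberTheory.DiophantineGeometry.hasMultiplicativeReductionAt_freyCurve_of_ne_two
      hab h0 v (by rw [hv]; decide) ?_
    rw [hv]; norm_num

end Summit.ABC.ABC.Cruxes.FreyModularity.StubIdeas3G3

end
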